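import Mathlib.MeasureTheory.Integral.Marginal
import Mathlib.Analysis.SpecialFunctions.ImproperIntegrals
import Mathlib.Analysis.SpecialFunctions.Integrals.Basic
import HarnessLib

/-!
# Hepp's sector integral in the affine chart

Topic `MathematicalPhysics/QuantumFieldTheory`; the calculus input of the proof of the named fact
`Panzer2022_period_le_hepp` (`HeppBound.lean`; the Hepp bound bounds the period, Panzer 2022,
eq. (1.6)). Source: E. Panzer, *Hepp's bound for Feynman graphs and matroids*, AIHPD 10 (2023) =
arXiv:1908.09820 [Panzer2022], §2.2 (the integral over one Hepp sector
`0 < x_{σ(1)} < ⋯ < x_{σ(N)}` of the sector monomial is `1/(ω(G^σ_1)⋯ω(G^σ_{N-1}))`, computed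
there in the chart `x_{σ(N)} = 1`); K. Hepp, Comm. Math. Phys. 2 (1966) 301–326 (sectors).

## What is proved (namespace `Literature.MathematicalPhysics.QuantumFieldTheory`)

We stay in the FIXED affine chart `x_N = 1` of the tree's `graphPeriod` (`GraphPeriod.lean`): a
sector is described by `n + 1` positions `k = 0, …, n` carrying the values
`sv x k = if k = m then 1 else x (c k)` of a point `x : Fin n → ℝ` (`m` = the position of the edge
whose weight is set to `1`, `c k` = the coordinate sitting at position `k ≠ m`), and by "degrees"
`d k` (`= ω(G^σ_k) = k - 2 h₁(G^σ_k)` in the application) with `d 0 = d (n+1) = 0`. The lower chain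
functional `L i` (positions `i … m`: indicator of `0 < sv x i ≤ ⋯ ≤ sv x m` times
`Π_{i ≤ k < m} (sv x k)^{d(k+1)-d k-1}`) and the upper one `U j` (positions `m … j`: indicator of
`1 ≤ sv x m ≤ ⋯ ≤ sv x j` times `Π_{m < k ≤ j} (sv x k)^{d(k+1)-d k-1}`) are HYPOTHESES of the
form `∀ x, F x = <formula>` (no definitions are introduced; the user instantiates them by `rfl`).

* `lmarginal_lower`, `lmarginal_upper` — iterated integration of the two chains with Mathlib's
  marginal integrals `∫⋯∫⁻_s, f` (`lmarginal`): from the bottom `∫_0^b t^{D-1} dt = b^D/D`, from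
  the top `∫_b^∞ t^{-W-1} dt = b^{-W}/W`, each step absorbing the boundary power into the next
  variable — which is why no change of chart is needed.
* `lintegral_lower_mul_upper` — **the sector integral**:
  `∫_{ℝⁿ} L 0 · U n = Π_{k=1}^{n} (d k)⁻¹` when all `d k > 0` (`1 ≤ k ≤ n`), Panzer's value
  `1/(ω(G^σ_1)⋯ω(G^σ_{N-1}))` of one Hepp sector (§2.2, display before Prop. 2.9).
-/

noncomputable section

open MeasureTheory ENNReal Finset Function

namespace Literature.MathematicalPhysics.QuantumFieldTheory

/-! ### Two one-dimensional integrals -/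

/-- `∫_{(0,b]} t^{D-1} dt = b^D / D` as a lower Lebesgue integral (`D > 0`, `b ≥ 0`). [folklore] -/
theorem lintegral_Ioc_rpow_sub_one {b D : ℝ} (hD : 0 < D) (hb : 0 ≤ b) :
    ∫⁻ t in Set.Ioc 0 b, ENNReal.ofReal (t ^ (D - 1)) = ENNReal.ofReal (b ^ D / D) := by
  have hint : IntegrableOn (fun t : ℝ => t ^ (D - 1)) (Set.Ioc 0 b) :=
    (intervalIntegrable_iff_integrableOn_Ioc_of_le hb).1
      (intervalIntegral.intervalIntegrable_rpow' (by linarith))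
  rw [← ofReal_integral_eq_lintegral_ofReal hint ((ae_restrict_iff' measurableSet_Ioc).2
      (ae_of_all _ fun t ht => Real.rpow_nonneg ht.1.le _)),
    ← intervalIntegral.integral_of_le hb, integral_rpow (Or.inl (by linarith)), sub_add_cancel,
    Real.zero_rpow hD.ne', sub_zero]

/-- `∫_{[b,∞)} t^{-W-1} dt = b^{-W} / W` as a lower Lebesgue integral (`W > 0`, `b > 0`). [folklore] -/
theorem lintegral_Ici_rpow_neg_sub_one {b W : ℝ} (hW : 0 < W) (hb : 0 < b) :
    ∫⁻ t in Set.Ici b, ENNReal.ofReal (t ^ (-W - 1)) = ENNReal.ofReal (b ^ (-W) / W) := by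
  have hint : IntegrableOn (fun t : ℝ => t ^ (-W - 1)) (Set.Ioi b) :=
    integrableOn_Ioi_rpow_of_lt (by linarith) hb
  rw [← setLIntegral_congr Ioi_ae_eq_Ici, ← ofReal_integral_eq_lintegral_ofReal hint
      ((ae_restrict_iff' measurableSet_Ioi).2
        (ae_of_all _ fun t ht => Real.rpow_nonneg (hb.le.trans (le_of_lt ht)) _)),
    integral_Ioi_rpow_of_lt (by linarith) hb]
  congr 1
  rw [show -W - 1 + 1 = -W by ring, neg_div, div_neg, neg_neg]

/-- Indicators of `1` agree at points whose memberships are equivalent. [folklore] -/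
theorem indicator_one_eq_indicator_one {α β : Type*} {s : Set α} {s' : Set β} {a : α} {b : β}
    (h : a ∈ s ↔ b ∈ s') :
    s.indicator (1 : α → ℝ≥0∞) a = s'.indicator (1 : β → ℝ≥0∞) b := by
  by_cases hb : b ∈ s'
  · rw [Set.indicator_of_mem hb, Set.indicator_of_mem (h.2 hb), Pi.one_apply, Pi.one_apply]
  · rw [Set.indicator_of_notMem hb, Set.indicator_of_notMem (mt h.1 hb)]

/-! ### The two chains of a sector -/

section Chains

variable {n m : ℕ} {c : ℕ → Fin n} {d : ℕ → ℝ} {sv : (Fin n → ℝ) → ℕ → ℝ}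
  {L U : ℕ → (Fin n → ℝ) → ℝ≥0∞}

/-- The value at a position is unchanged by updating a coordinate not sitting there. [folklore] -/
theorem sv_update_of_ne (hsv : ∀ x k, sv x k = if k = m then 1 else x (c k))
    (x : Fin n → ℝ) (e : Fin n) (t : ℝ) {k : ℕ} (hk : k ≠ m → c k ≠ e) :
    sv (update x e t) k = sv x k := by
  rw [hsv, hsv]
  split_ifs with h
  · rfl
  · exact update_of_ne (hk h) t x

/-- Updating the coordinate sitting at position `k ≠ m` sets the value there. [folklore] -/
theorem sv_update_self (hsv : ∀ x k, sv x k = if k = m then 1 else x (c k))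
    (x : Fin n → ℝ) (t : ℝ) {k : ℕ} (hk : k ≠ m) : sv (update x (c k) t) k = t := by
  rw [hsv, if_neg hk, update_self]

/-- The value at the special position is `1`. [folklore] -/
theorem sv_self (hsv : ∀ x k, sv x k = if k = m then 1 else x (c k)) (x : Fin n → ℝ) :
    sv x m = 1 := by
  rw [hsv, if_pos rfl]

/-- Each value is a measurable function of the point. [folklore] -/
theorem measurable_sv (hsv : ∀ x k, sv x k = if k = m then 1 else x (c k)) (k : ℕ) :
    Measurable fun x => sv x k := by
  have h : (fun x => sv x k) = fun x : Fin n → ℝ => if k = m then (1 : ℝ) else x (c k) :=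
    funext fun x => hsv x k
  rw [h]
  by_cases hk : k = m
  · simp only [hk, if_true]
    exact measurable_const
  · simp only [hk, if_false]
    exact measurable_pi_apply (c k)

/-- A chain set `{p x ∧ ∀ k ∈ s, sv x k ≤ sv x (k+1) ∧ b ≤ sv x k}` is measurable. [folklore] -/
theorem measurableSet_chain (hsv : ∀ x k, sv x k = if k = m then 1 else x (c k))
    {p : (Fin n → ℝ) → Prop} (hp : MeasurableSet {x | p x}) (s : Finset ℕ) (b : ℝ) :
    MeasurableSet {x : Fin n → ℝ | p x ∧ ∀ k ∈ s, sv x k ≤ sv x (k + 1) ∧ b ≤ sv x k} := by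
  have h : {x : Fin n → ℝ | p x ∧ ∀ k ∈ s, sv x k ≤ sv x (k + 1) ∧ b ≤ sv x k} =
      {x | p x} ∩ ⋂ k ∈ s, ({x | sv x k ≤ sv x (k + 1)} ∩ {x | b ≤ sv x k}) := by
    ext x
    simp only [Set.mem_setOf_eq, Set.mem_inter_iff, Set.mem_iInter]
  rw [h]
  exact hp.inter (s.measurableSet_biInter fun k _ =>
    (measurableSet_le (measurable_sv hsv k) (measurable_sv hsv (k + 1))).inter
      (measurableSet_le measurable_const (measurable_sv hsv k)))

/-! #### The lower chain (positions `i, …, m`), integrated from the bottom -/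

/-- The lower chain functional is measurable. [folklore] -/
theorem measurable_lower (hsv : ∀ x k, sv x k = if k = m then 1 else x (c k))
    (hL : ∀ i x, L i x = {x | 0 < sv x i ∧ ∀ k ∈ Ico i m,
      sv x k ≤ sv x (k + 1) ∧ 0 ≤ sv x k}.indicator 1 x *
        ∏ k ∈ Ico i m, ENNReal.ofReal (sv x k ^ (d (k + 1) - d k - 1))) (i : ℕ) :
    Measurable (L i) := by
  rw [show L i = _ from funext (hL i)]
  exact (measurable_one.indicator (measurableSet_chain hsv
    (measurableSet_lt measurable_const (measurable_sv hsv i)) _ 0)).mul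
    (Finset.measurable_prod _ fun k _ => ((measurable_sv hsv k).pow_const _).ennreal_ofReal)

/-- The lower chain functional does not depend on coordinates off its positions. [folklore] -/
theorem lower_update (hsv : ∀ x k, sv x k = if k = m then 1 else x (c k))
    (hL : ∀ i x, L i x = {x | 0 < sv x i ∧ ∀ k ∈ Ico i m,
      sv x k ≤ sv x (k + 1) ∧ 0 ≤ sv x k}.indicator 1 x *
        ∏ k ∈ Ico i m, ENNReal.ofReal (sv x k ^ (d (k + 1) - d k - 1)))
    {i : ℕ} (hi : i ≤ m) (e : Fin n) (he : ∀ k ∈ Ico i m, c k ≠ e) (x : Fin n → ℝ) (t : ℝ) :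
    L i (update x e t) = L i x := by
  have hk : ∀ k, i ≤ k → k ≤ m → sv (update x e t) k = sv x k := fun k hik hkm =>
    sv_update_of_ne hsv x e t fun hne => he k (mem_Ico.2 ⟨hik, lt_of_le_of_ne hkm hne⟩)
  have hiff : (0 < sv (update x e t) i ∧ ∀ k ∈ Ico i m,
      sv (update x e t) k ≤ sv (update x e t) (k + 1) ∧ 0 ≤ sv (update x e t) k) ↔
      (0 < sv x i ∧ ∀ k ∈ Ico i m, sv x k ≤ sv x (k + 1) ∧ 0 ≤ sv x k) := by
    rw [hk i le_rfl hi]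
    refine and_congr_right fun _ => forall₂_congr fun k hk' => ?_
    rw [mem_Ico] at hk'
    rw [hk k hk'.1 hk'.2.le, hk (k + 1) (by omega) (by omega)]
  rw [hL, hL]
  congr 1
  · exact indicator_one_eq_indicator_one hiff
  · refine prod_congr rfl fun k hk' => ?_
    rw [mem_Ico] at hk'
    rw [hk k hk'.1 hk'.2.le]

/-- **One step of the lower chain**: integrating out the bottom position `i < m`,
`∫ L_i(x|_{c i = t}) t^{d i} dt = (d (i+1))⁻¹ · L_{i+1}(x) · (sv x (i+1))^{d (i+1)}`
(`∫_0^b t^{D-1} dt = b^D/D` with `D = d (i+1) > 0`). [cite: Panzer2022, §2.2 (sector integral)] -/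
theorem lintegral_lower_step (hsv : ∀ x k, sv x k = if k = m then 1 else x (c k))
    (hL : ∀ i x, L i x = {x | 0 < sv x i ∧ ∀ k ∈ Ico i m,
      sv x k ≤ sv x (k + 1) ∧ 0 ≤ sv x k}.indicator 1 x *
        ∏ k ∈ Ico i m, ENNReal.ofReal (sv x k ^ (d (k + 1) - d k - 1)))
    (hinj : ∀ k k', k ≤ n → k' ≤ n → k ≠ m → k' ≠ m → c k = c k' → k = k') (hmn : m ≤ n)
    {i : ℕ} (hi : i < m) (hD : 0 < d (i + 1)) (x : Fin n → ℝ) :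
    ∫⁻ t, L i (update x (c i) t) * ENNReal.ofReal (sv (update x (c i) t) i ^ d i) =
      ENNReal.ofReal (d (i + 1))⁻¹ *
        (L (i + 1) x * ENNReal.ofReal (sv x (i + 1) ^ d (i + 1))) := by
  set b : ℝ := sv x (i + 1) with hb
  set P' : ℝ≥0∞ := ∏ k ∈ Ico (i + 1) m, ENNReal.ofReal (sv x k ^ (d (k + 1) - d k - 1)) with hP'
  have hsvi : ∀ t, sv (update x (c i) t) i = t := fun t => sv_update_self hsv x t hi.ne
  have hrest : ∀ t k, i + 1 ≤ k → k ≤ m → sv (update x (c i) t) k = sv x k :=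
    fun t k h1 h2 => sv_update_of_ne hsv x (c i) t fun hkm hce =>
      absurd (hinj k i (by omega) (by omega) hkm hi.ne hce) (by omega)
  have hIco : Ico i m = insert i (Ico (i + 1) m) := by
    ext k; simp only [mem_Ico, Finset.mem_insert]; omega
  have hnot : i ∉ Ico (i + 1) m := by simp
  -- the chain functional at the updated point
  have hexp : ∀ t, L i (update x (c i) t) =
      {t : ℝ | 0 < t ∧ (t ≤ b ∧ 0 ≤ t) ∧ ∀ k ∈ Ico (i + 1) m,
          sv x k ≤ sv x (k + 1) ∧ 0 ≤ sv x k}.indicator 1 t *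
        (ENNReal.ofReal (t ^ (d (i + 1) - d i - 1)) * P') := by
    intro t
    have hiff : (0 < sv (update x (c i) t) i ∧ ∀ k ∈ insert i (Ico (i + 1) m),
        sv (update x (c i) t) k ≤ sv (update x (c i) t) (k + 1) ∧ 0 ≤ sv (update x (c i) t) k) ↔
        (0 < t ∧ (t ≤ b ∧ 0 ≤ t) ∧ ∀ k ∈ Ico (i + 1) m, sv x k ≤ sv x (k + 1) ∧ 0 ≤ sv x k) := by
      rw [Finset.forall_mem_insert, hsvi t, hrest t (i + 1) le_rfl (by omega)]
      refine and_congr_right fun _ => and_congr_right fun _ => forall₂_congr fun k hk' => ?_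
      rw [mem_Ico] at hk'
      rw [hrest t k hk'.1 hk'.2.le, hrest t (k + 1) (by omega) (by omega)]
    rw [hL, hIco, prod_insert hnot, hsvi t]
    congr 1
    · exact indicator_one_eq_indicator_one hiff
    · rw [hP']
      exact congrArg _ (prod_congr rfl fun k hk' => by
        rw [mem_Ico] at hk'
        rw [hrest t k hk'.1 hk'.2.le])
  simp_rw [hexp, hsvi]
  set S : Set ℝ := {t : ℝ | 0 < t ∧ (t ≤ b ∧ 0 ≤ t) ∧ ∀ k ∈ Ico (i + 1) m,
    sv x k ≤ sv x (k + 1) ∧ 0 ≤ sv x k} with hS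
  by_cases hQ : ∀ k ∈ Ico (i + 1) m, sv x k ≤ sv x (k + 1) ∧ 0 ≤ sv x k
  · by_cases hb0 : 0 < b
    · -- the generic case: an honest integral over `(0, b]`
      have hmem : x ∈ {x : Fin n → ℝ | 0 < sv x (i + 1) ∧ ∀ k ∈ Ico (i + 1) m,
          sv x k ≤ sv x (k + 1) ∧ 0 ≤ sv x k} := ⟨hb0, hQ⟩
      have hL1 : L (i + 1) x = P' := by
        rw [hL, Set.indicator_of_mem hmem, Pi.one_apply, one_mul]
      have hint : (fun t : ℝ => S.indicator 1 t *
          (ENNReal.ofReal (t ^ (d (i + 1) - d i - 1)) * P') * ENNReal.ofReal (t ^ d i)) =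
          fun t => (Set.Ioc 0 b).indicator (fun t => ENNReal.ofReal (t ^ (d (i + 1) - 1))) t *
            P' := by
        funext t
        by_cases ht : t ∈ Set.Ioc 0 b
        · rw [Set.indicator_of_mem (show t ∈ S from ⟨ht.1, ⟨ht.2, ht.1.le⟩, hQ⟩),
            Set.indicator_of_mem ht, Pi.one_apply, one_mul, mul_assoc, mul_comm P', ← mul_assoc,
            ← ENNReal.ofReal_mul (Real.rpow_nonneg ht.1.le _), ← Real.rpow_add ht.1]
          congr 3
          ring
        · rw [Set.indicator_of_notMem (show t ∉ S from fun h => ht ⟨h.1, h.2.1.1⟩),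
            Set.indicator_of_notMem ht, zero_mul, zero_mul, zero_mul]
      rw [hint, lintegral_mul_const _ ((show Measurable fun t : ℝ =>
          ENNReal.ofReal (t ^ (d (i + 1) - 1)) from
            (measurable_id.pow_const _).ennreal_ofReal).indicator measurableSet_Ioc),
        lintegral_indicator measurableSet_Ioc,
        lintegral_Ioc_rpow_sub_one hD hb0.le, hL1, div_eq_mul_inv,
        ENNReal.ofReal_mul (Real.rpow_nonneg hb0.le _)]
      ring
    · -- `b ≤ 0`: both sides vanish
      have hL1 : L (i + 1) x = 0 := by
        rw [hL, Set.indicator_of_notMem (show x ∉ {x | _} from fun h => hb0 h.1), zero_mul]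
      have hint : (fun t : ℝ => S.indicator 1 t *
          (ENNReal.ofReal (t ^ (d (i + 1) - d i - 1)) * P') * ENNReal.ofReal (t ^ d i)) =
          fun _ => 0 := by
        funext t
        rw [Set.indicator_of_notMem (show t ∉ S from fun h => hb0 (h.1.trans_le h.2.1.1)),
          zero_mul, zero_mul]
      rw [hint, hL1, lintegral_zero, zero_mul, mul_zero]
  · -- the chain above is broken: both sides vanish
    have hL1 : L (i + 1) x = 0 := by
      rw [hL, Set.indicator_of_notMem (show x ∉ {x | _} from fun h => hQ h.2), zero_mul]
    have hint : (fun t : ℝ => S.indicator 1 t *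
        (ENNReal.ofReal (t ^ (d (i + 1) - d i - 1)) * P') * ENNReal.ofReal (t ^ d i)) =
        fun _ => 0 := by
      funext t
      rw [Set.indicator_of_notMem (show t ∉ S from fun h => hQ h.2.2), zero_mul, zero_mul]
    rw [hint, hL1, lintegral_zero, zero_mul, mul_zero]

/-- **The lower chain integrates to `Π (d k)⁻¹`.** For `i ≤ m ≤ n` and any measurable weight `h`
not depending on the coordinates at positions `i, …, m-1`:
`∫⋯∫_{positions i…m-1} h · L_i · (sv · i)^{d i} = (Π_{k=i+1}^{m} (d k)⁻¹) · h`.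
[cite: Panzer2022, §2.2 (sector integral)] -/
theorem lmarginal_lower (hsv : ∀ x k, sv x k = if k = m then 1 else x (c k))
    (hL : ∀ i x, L i x = {x | 0 < sv x i ∧ ∀ k ∈ Ico i m,
      sv x k ≤ sv x (k + 1) ∧ 0 ≤ sv x k}.indicator 1 x *
        ∏ k ∈ Ico i m, ENNReal.ofReal (sv x k ^ (d (k + 1) - d k - 1)))
    (hinj : ∀ k k', k ≤ n → k' ≤ n → k ≠ m → k' ≠ m → c k = c k' → k = k') (hmn : m ≤ n)
    (hd : ∀ k, 1 ≤ k → k ≤ m → 0 < d k) :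
    ∀ j i, i + j = m → ∀ h : (Fin n → ℝ) → ℝ≥0∞, Measurable h →
      (∀ x k t, k ∈ Ico i m → h (update x (c k) t) = h x) →
        lmarginal (fun _ => volume) ((Ico i m).image c)
            (fun x => h x * (L i x * ENNReal.ofReal (sv x i ^ d i))) =
          fun x => ENNReal.ofReal (∏ k ∈ Ico (i + 1) (m + 1), (d k)⁻¹) * h x := by
  classical
  intro j
  induction j with
  | zero =>
    intro i him h _ _
    obtain rfl : m = i := by omega
    rw [Finset.Ico_self, image_empty, lmarginal_empty, Finset.Ico_self, prod_empty,
      ENNReal.ofReal_one]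
    funext x
    have hmem : x ∈ {x : Fin n → ℝ | 0 < sv x m ∧ ∀ k ∈ Ico m m,
        sv x k ≤ sv x (k + 1) ∧ 0 ≤ sv x k} := ⟨by rw [sv_self hsv]; exact one_pos, by simp⟩
    rw [hL, Set.indicator_of_mem hmem, Pi.one_apply, one_mul, Finset.Ico_self, prod_empty,
      one_mul, sv_self hsv, Real.one_rpow, ENNReal.ofReal_one, mul_one, one_mul]
  | succ j ih =>
    intro i him h hh hinv
    have hi : i < m := by omega
    have hIco : (Ico i m).image c = insert (c i) ((Ico (i + 1) m).image c) := by
      rw [← image_insert]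
      congr 1
      ext k; simp only [mem_Ico, Finset.mem_insert]; omega
    have hnot : c i ∉ (Ico (i + 1) m).image c := by
      simp only [mem_image, mem_Ico, not_exists, not_and]
      intro k hk hce
      have := hinj k i (by omega) (by omega) (by omega) hi.ne hce
      omega
    have hmeas : Measurable fun x => h x * (L i x * ENNReal.ofReal (sv x i ^ d i)) :=
      hh.mul ((measurable_lower hsv hL i).mul ((measurable_sv hsv i).pow_const _).ennreal_ofReal)
    rw [hIco, lmarginal_insert' _ hmeas hnot]
    have hinner : (fun x => ∫⁻ t, (fun x => h x * (L i x * ENNReal.ofReal (sv x i ^ d i)))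
        (update x (c i) t)) = fun x => (ENNReal.ofReal (d (i + 1))⁻¹ * h x) *
          (L (i + 1) x * ENNReal.ofReal (sv x (i + 1) ^ d (i + 1))) := by
      funext x
      have hhx : ∀ t, h (update x (c i) t) = h x := fun t => hinv x i t (by simp [hi])
      simp only [hhx]
      have hm1 : Measurable fun t : ℝ => L i (update x (c i) t) :=
        (measurable_lower hsv hL i).comp (measurable_update x)
      have hm2 : Measurable fun t : ℝ => sv (update x (c i) t) i :=
        (measurable_sv hsv i).comp (measurable_update x)
      have hm : Measurable fun t : ℝ => L i (update x (c i) t) *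
          ENNReal.ofReal (sv (update x (c i) t) i ^ d i) :=
        hm1.mul (hm2.pow_const _).ennreal_ofReal
      rw [lintegral_const_mul _ hm,
        lintegral_lower_step hsv hL hinj hmn hi (hd (i + 1) (by omega) (by omega)) x]
      ring
    rw [hinner, ih (i + 1) (by omega) (fun x => ENNReal.ofReal (d (i + 1))⁻¹ * h x)
      (measurable_const.mul hh) (fun x k t hk => by
        rw [hinv x k t (Finset.Ico_subset_Ico_left (Nat.le_succ i) hk)])]
    funext x
    rw [prod_eq_prod_Ico_succ_bot (show i + 1 < m + 1 by omega),
      ENNReal.ofReal_mul (inv_nonneg.2 (hd (i + 1) (by omega) (by omega)).le)]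
    ring

/-! #### The upper chain (positions `m, …, j`), integrated from the top -/

/-- The upper chain functional is measurable. [folklore] -/
theorem measurable_upper (hsv : ∀ x k, sv x k = if k = m then 1 else x (c k))
    (hU : ∀ j x, U j x = {x | 1 ≤ sv x j ∧ ∀ k ∈ Ico m j,
      sv x k ≤ sv x (k + 1) ∧ 1 ≤ sv x k}.indicator 1 x *
        ∏ k ∈ Ico (m + 1) (j + 1), ENNReal.ofReal (sv x k ^ (d (k + 1) - d k - 1))) (j : ℕ) :
    Measurable (U j) := by
  rw [show U j = _ from funext (hU j)]
  exact (measurable_one.indicator (measurableSet_chain hsv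
    (measurableSet_le measurable_const (measurable_sv hsv j)) _ 1)).mul
    (Finset.measurable_prod _ fun k _ => ((measurable_sv hsv k).pow_const _).ennreal_ofReal)

/-- The upper chain functional does not depend on coordinates off its positions. [folklore] -/
theorem upper_update (hsv : ∀ x k, sv x k = if k = m then 1 else x (c k))
    (hU : ∀ j x, U j x = {x | 1 ≤ sv x j ∧ ∀ k ∈ Ico m j,
      sv x k ≤ sv x (k + 1) ∧ 1 ≤ sv x k}.indicator 1 x *
        ∏ k ∈ Ico (m + 1) (j + 1), ENNReal.ofReal (sv x k ^ (d (k + 1) - d k - 1)))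
    {j : ℕ} (hj : m ≤ j) (e : Fin n) (he : ∀ k ∈ Ioc m j, c k ≠ e) (x : Fin n → ℝ) (t : ℝ) :
    U j (update x e t) = U j x := by
  have hk : ∀ k, m ≤ k → k ≤ j → sv (update x e t) k = sv x k := fun k h1 h2 =>
    sv_update_of_ne hsv x e t fun hne => he k (mem_Ioc.2 ⟨lt_of_le_of_ne h1 (Ne.symm hne), h2⟩)
  have hiff : (1 ≤ sv (update x e t) j ∧ ∀ k ∈ Ico m j,
      sv (update x e t) k ≤ sv (update x e t) (k + 1) ∧ 1 ≤ sv (update x e t) k) ↔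
      (1 ≤ sv x j ∧ ∀ k ∈ Ico m j, sv x k ≤ sv x (k + 1) ∧ 1 ≤ sv x k) := by
    rw [hk j hj le_rfl]
    refine and_congr_right fun _ => forall₂_congr fun k hk' => ?_
    rw [mem_Ico] at hk'
    rw [hk k hk'.1 hk'.2.le, hk (k + 1) (by omega) (by omega)]
  rw [hU, hU]
  congr 1
  · exact indicator_one_eq_indicator_one hiff
  · refine prod_congr rfl fun k hk' => ?_
    rw [mem_Ico] at hk'
    rw [hk k (by omega) (by omega)]

/-- **One step of the upper chain**: integrating out the top position `j + 1 ≤ n`,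
`∫ U_{j+1}(x|_{c (j+1) = t}) t^{-d(j+2)} dt = (d (j+1))⁻¹ · U_j(x) · (sv x j)^{-d (j+1)}`
(`∫_b^∞ t^{-W-1} dt = b^{-W}/W` with `W = d (j+1) > 0`). [cite: Panzer2022, §2.2 (sector integral)] -/
theorem lintegral_upper_step (hsv : ∀ x k, sv x k = if k = m then 1 else x (c k))
    (hU : ∀ j x, U j x = {x | 1 ≤ sv x j ∧ ∀ k ∈ Ico m j,
      sv x k ≤ sv x (k + 1) ∧ 1 ≤ sv x k}.indicator 1 x *
        ∏ k ∈ Ico (m + 1) (j + 1), ENNReal.ofReal (sv x k ^ (d (k + 1) - d k - 1)))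
    (hinj : ∀ k k', k ≤ n → k' ≤ n → k ≠ m → k' ≠ m → c k = c k' → k = k')
    {j : ℕ} (hmj : m ≤ j) (hjn : j + 1 ≤ n) (hD : 0 < d (j + 1)) (x : Fin n → ℝ) :
    ∫⁻ t, U (j + 1) (update x (c (j + 1)) t) *
        ENNReal.ofReal (sv (update x (c (j + 1)) t) (j + 1) ^ (-d (j + 1 + 1))) =
      ENNReal.ofReal (d (j + 1))⁻¹ * (U j x * ENNReal.ofReal (sv x j ^ (-d (j + 1)))) := by
  set b : ℝ := sv x j with hb
  set P' : ℝ≥0∞ := ∏ k ∈ Ico (m + 1) (j + 1), ENNReal.ofReal (sv x k ^ (d (k + 1) - d k - 1))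
    with hP'
  have hsvj : ∀ t, sv (update x (c (j + 1)) t) (j + 1) = t :=
    fun t => sv_update_self hsv x t (show j + 1 ≠ m by omega)
  have hrest : ∀ t k, m ≤ k → k ≤ j → sv (update x (c (j + 1)) t) k = sv x k :=
    fun t k h1 h2 => sv_update_of_ne hsv x (c (j + 1)) t fun hkm hce =>
      absurd (hinj k (j + 1) (by omega) (by omega) hkm (by omega) hce) (by omega)
  have hIco1 : Ico m (j + 1) = insert j (Ico m j) := by
    ext k; simp only [mem_Ico, Finset.mem_insert]; omega
  have hIco2 : Ico (m + 1) (j + 1 + 1) = insert (j + 1) (Ico (m + 1) (j + 1)) := by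
    ext k; simp only [mem_Ico, Finset.mem_insert]; omega
  have hnot2 : j + 1 ∉ Ico (m + 1) (j + 1) := by simp
  -- the chain functional at the updated point
  have hexp : ∀ t, U (j + 1) (update x (c (j + 1)) t) =
      {t : ℝ | 1 ≤ t ∧ (b ≤ t ∧ 1 ≤ b) ∧ ∀ k ∈ Ico m j,
          sv x k ≤ sv x (k + 1) ∧ 1 ≤ sv x k}.indicator 1 t *
        (ENNReal.ofReal (t ^ (d (j + 1 + 1) - d (j + 1) - 1)) * P') := by
    intro t
    have hiff : (1 ≤ sv (update x (c (j + 1)) t) (j + 1) ∧ ∀ k ∈ insert j (Ico m j),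
        sv (update x (c (j + 1)) t) k ≤ sv (update x (c (j + 1)) t) (k + 1) ∧
          1 ≤ sv (update x (c (j + 1)) t) k) ↔
        (1 ≤ t ∧ (b ≤ t ∧ 1 ≤ b) ∧ ∀ k ∈ Ico m j, sv x k ≤ sv x (k + 1) ∧ 1 ≤ sv x k) := by
      rw [Finset.forall_mem_insert, hsvj t, hrest t j hmj le_rfl]
      refine and_congr_right fun _ => and_congr_right fun _ => forall₂_congr fun k hk' => ?_
      rw [mem_Ico] at hk'
      rw [hrest t k hk'.1 hk'.2.le, hrest t (k + 1) (by omega) (by omega)]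
    rw [hU, hIco1, hIco2, prod_insert hnot2, hsvj t]
    congr 1
    · exact indicator_one_eq_indicator_one hiff
    · rw [hP']
      exact congrArg _ (prod_congr rfl fun k hk' => by
        rw [mem_Ico] at hk'
        rw [hrest t k (by omega) (by omega)])
  simp_rw [hexp, hsvj]
  set S : Set ℝ := {t : ℝ | 1 ≤ t ∧ (b ≤ t ∧ 1 ≤ b) ∧ ∀ k ∈ Ico m j,
    sv x k ≤ sv x (k + 1) ∧ 1 ≤ sv x k} with hS
  by_cases hQ : ∀ k ∈ Ico m j, sv x k ≤ sv x (k + 1) ∧ 1 ≤ sv x k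
  · by_cases hb1 : 1 ≤ b
    · -- the generic case: an honest integral over `[b, ∞)`
      have hmem : x ∈ {x : Fin n → ℝ | 1 ≤ sv x j ∧ ∀ k ∈ Ico m j,
          sv x k ≤ sv x (k + 1) ∧ 1 ≤ sv x k} := ⟨hb1, hQ⟩
      have hU1 : U j x = P' := by
        rw [hU, Set.indicator_of_mem hmem, Pi.one_apply, one_mul]
      have hint : (fun t : ℝ => S.indicator 1 t *
          (ENNReal.ofReal (t ^ (d (j + 1 + 1) - d (j + 1) - 1)) * P') *
            ENNReal.ofReal (t ^ (-d (j + 1 + 1)))) =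
          fun t => (Set.Ici b).indicator (fun t => ENNReal.ofReal (t ^ (-d (j + 1) - 1))) t *
            P' := by
        funext t
        by_cases ht : t ∈ Set.Ici b
        · have hbt : b ≤ t := ht
          have ht0 : 0 < t := one_pos.trans_le (hb1.trans hbt)
          rw [Set.indicator_of_mem (show t ∈ S from ⟨hb1.trans hbt, ⟨hbt, hb1⟩, hQ⟩),
            Set.indicator_of_mem ht, Pi.one_apply, one_mul, mul_assoc, mul_comm P', ← mul_assoc,
            ← ENNReal.ofReal_mul (Real.rpow_nonneg ht0.le _), ← Real.rpow_add ht0]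
          congr 3
          ring
        · rw [Set.indicator_of_notMem (show t ∉ S from fun h => ht h.2.1.1),
            Set.indicator_of_notMem ht, zero_mul, zero_mul, zero_mul]
      rw [hint, lintegral_mul_const _ ((show Measurable fun t : ℝ =>
          ENNReal.ofReal (t ^ (-d (j + 1) - 1)) from
            (measurable_id.pow_const _).ennreal_ofReal).indicator measurableSet_Ici),
        lintegral_indicator measurableSet_Ici,
        lintegral_Ici_rpow_neg_sub_one hD (one_pos.trans_le hb1), hU1, div_eq_mul_inv,
        ENNReal.ofReal_mul (Real.rpow_nonneg (zero_le_one.trans hb1) _)]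
      ring
    · -- `b < 1`: both sides vanish
      have hU1 : U j x = 0 := by
        rw [hU, Set.indicator_of_notMem (show x ∉ {x | _} from fun h => hb1 h.1), zero_mul]
      have hint : (fun t : ℝ => S.indicator 1 t *
          (ENNReal.ofReal (t ^ (d (j + 1 + 1) - d (j + 1) - 1)) * P') *
            ENNReal.ofReal (t ^ (-d (j + 1 + 1)))) = fun _ => 0 := by
        funext t
        rw [Set.indicator_of_notMem (show t ∉ S from fun h => hb1 h.2.1.2), zero_mul, zero_mul]
      rw [hint, hU1, lintegral_zero, zero_mul, mul_zero]
  · -- the chain below is broken: both sides vanish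
    have hU1 : U j x = 0 := by
      rw [hU, Set.indicator_of_notMem (show x ∉ {x | _} from fun h => hQ h.2), zero_mul]
    have hint : (fun t : ℝ => S.indicator 1 t *
        (ENNReal.ofReal (t ^ (d (j + 1 + 1) - d (j + 1) - 1)) * P') *
          ENNReal.ofReal (t ^ (-d (j + 1 + 1)))) = fun _ => 0 := by
      funext t
      rw [Set.indicator_of_notMem (show t ∉ S from fun h => hQ h.2.2), zero_mul, zero_mul]
    rw [hint, hU1, lintegral_zero, zero_mul, mul_zero]

/-- **The upper chain integrates to `Π (d k)⁻¹`.** For `m ≤ j ≤ n` and any measurable weight `h`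
not depending on the coordinates at positions `m+1, …, j`:
`∫⋯∫_{positions m+1…j} h · U_j · (sv · j)^{-d (j+1)} = (Π_{k=m+1}^{j} (d k)⁻¹) · h`.
[cite: Panzer2022, §2.2 (sector integral)] -/
theorem lmarginal_upper (hsv : ∀ x k, sv x k = if k = m then 1 else x (c k))
    (hU : ∀ j x, U j x = {x | 1 ≤ sv x j ∧ ∀ k ∈ Ico m j,
      sv x k ≤ sv x (k + 1) ∧ 1 ≤ sv x k}.indicator 1 x *
        ∏ k ∈ Ico (m + 1) (j + 1), ENNReal.ofReal (sv x k ^ (d (k + 1) - d k - 1)))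
    (hinj : ∀ k k', k ≤ n → k' ≤ n → k ≠ m → k' ≠ m → c k = c k' → k = k')
    (hd : ∀ k, m + 1 ≤ k → k ≤ n → 0 < d k) {j : ℕ} (hmj : m ≤ j) :
    j ≤ n → ∀ h : (Fin n → ℝ) → ℝ≥0∞, Measurable h →
      (∀ x k t, k ∈ Ico (m + 1) (j + 1) → h (update x (c k) t) = h x) →
        lmarginal (fun _ => volume) ((Ico (m + 1) (j + 1)).image c)
            (fun x => h x * (U j x * ENNReal.ofReal (sv x j ^ (-d (j + 1))))) =
          fun x => ENNReal.ofReal (∏ k ∈ Ico (m + 1) (j + 1), (d k)⁻¹) * h x := by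
  classical
  induction j, hmj using Nat.le_induction with
  | base =>
    intro _ h _ _
    rw [Finset.Ico_self, image_empty, lmarginal_empty, prod_empty, ENNReal.ofReal_one]
    funext x
    have hmem : x ∈ {x : Fin n → ℝ | 1 ≤ sv x m ∧ ∀ k ∈ Ico m m,
        sv x k ≤ sv x (k + 1) ∧ 1 ≤ sv x k} := ⟨by rw [sv_self hsv], by simp⟩
    rw [hU, Set.indicator_of_mem hmem, Pi.one_apply, one_mul, Finset.Ico_self, prod_empty,
      one_mul, sv_self hsv, Real.one_rpow, ENNReal.ofReal_one, mul_one, one_mul]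
  | succ j hmj ih =>
    intro hjn h hh hinv
    have hIco : (Ico (m + 1) (j + 1 + 1)).image c =
        insert (c (j + 1)) ((Ico (m + 1) (j + 1)).image c) := by
      rw [← image_insert]
      congr 1
      ext k; simp only [mem_Ico, Finset.mem_insert]; omega
    have hnot : c (j + 1) ∉ (Ico (m + 1) (j + 1)).image c := by
      simp only [mem_image, mem_Ico, not_exists, not_and]
      intro k hk hce
      have := hinj k (j + 1) (by omega) (by omega) (by omega) (by omega) hce
      omega
    have hmeas : Measurable fun x => h x *
        (U (j + 1) x * ENNReal.ofReal (sv x (j + 1) ^ (-d (j + 1 + 1)))) :=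
      hh.mul ((measurable_upper hsv hU (j + 1)).mul
        ((measurable_sv hsv (j + 1)).pow_const _).ennreal_ofReal)
    rw [hIco, lmarginal_insert' _ hmeas hnot]
    have hinner : (fun x => ∫⁻ t, (fun x => h x *
        (U (j + 1) x * ENNReal.ofReal (sv x (j + 1) ^ (-d (j + 1 + 1)))))
          (update x (c (j + 1)) t)) = fun x => (ENNReal.ofReal (d (j + 1))⁻¹ * h x) *
          (U j x * ENNReal.ofReal (sv x j ^ (-d (j + 1)))) := by
      funext x
      have hhx : ∀ t, h (update x (c (j + 1)) t) = h x :=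
        fun t => hinv x (j + 1) t (by simp; omega)
      simp only [hhx]
      have hm1 : Measurable fun t : ℝ => U (j + 1) (update x (c (j + 1)) t) :=
        (measurable_upper hsv hU (j + 1)).comp (measurable_update x)
      have hm2 : Measurable fun t : ℝ => sv (update x (c (j + 1)) t) (j + 1) :=
        (measurable_sv hsv (j + 1)).comp (measurable_update x)
      have hm : Measurable fun t : ℝ => U (j + 1) (update x (c (j + 1)) t) *
          ENNReal.ofReal (sv (update x (c (j + 1)) t) (j + 1) ^ (-d (j + 1 + 1))) :=
        hm1.mul (hm2.pow_const _).ennreal_ofReal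
      rw [lintegral_const_mul _ hm,
        lintegral_upper_step hsv hU hinj hmj hjn (hd (j + 1) (by omega) (by omega)) x]
      ring
    rw [hinner, ih (by omega) (fun x => ENNReal.ofReal (d (j + 1))⁻¹ * h x)
      (measurable_const.mul hh) (fun x k t hk => by
        rw [hinv x k t (Finset.Ico_subset_Ico_right (Nat.le_succ _) hk)])]
    funext x
    rw [prod_Ico_succ_top (show m + 1 ≤ j + 1 by omega),
      ENNReal.ofReal_mul' (inv_nonneg.2 (hd (j + 1) (by omega) (by omega)).le)]
    ring

/-! #### The sector integral -/

/-- **The integral over one Hepp sector in the affine chart** (Panzer 2022, §2.2, the display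
before Prop. 2.9, for unit indices): with the positions `0, …, n`, the special position `m ≤ n`
(value `1`), a bijection `c` from the other positions onto the coordinates, and degrees `d` with
`d 0 = d (n+1) = 0` and `d k > 0` for `1 ≤ k ≤ n`,
`∫_{ℝⁿ} L 0 · U n = Π_{k=1}^{n} (d k)⁻¹`; here `L 0 · U n` is the indicator of the closed sector
`0 < sv x 0 ≤ sv x 1 ≤ ⋯ ≤ sv x n` (with `1 ≤ sv x k` for `k ≥ m`) times the sector monomial
`Π_{k ≠ m} (sv x k)^{d (k+1) - d k - 1}`. [cite: Panzer2022, §2.2 (sector integral = 1/(ω(G^σ_1)⋯ω(G^σ_{N-1})))] -/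
theorem lintegral_lower_mul_upper (hsv : ∀ x k, sv x k = if k = m then 1 else x (c k))
    (hL : ∀ i x, L i x = {x | 0 < sv x i ∧ ∀ k ∈ Ico i m,
      sv x k ≤ sv x (k + 1) ∧ 0 ≤ sv x k}.indicator 1 x *
        ∏ k ∈ Ico i m, ENNReal.ofReal (sv x k ^ (d (k + 1) - d k - 1)))
    (hU : ∀ j x, U j x = {x | 1 ≤ sv x j ∧ ∀ k ∈ Ico m j,
      sv x k ≤ sv x (k + 1) ∧ 1 ≤ sv x k}.indicator 1 x *
        ∏ k ∈ Ico (m + 1) (j + 1), ENNReal.ofReal (sv x k ^ (d (k + 1) - d k - 1)))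
    (hmn : m ≤ n) (hinj : ∀ k k', k ≤ n → k' ≤ n → k ≠ m → k' ≠ m → c k = c k' → k = k')
    (hsurj : ∀ e : Fin n, ∃ k, k ≤ n ∧ k ≠ m ∧ c k = e)
    (hd0 : d 0 = 0) (hdn : d (n + 1) = 0) (hd : ∀ k, 1 ≤ k → k ≤ n → 0 < d k) :
    ∫⁻ x, L 0 x * U n x = ENNReal.ofReal (∏ k ∈ Ico 1 (n + 1), (d k)⁻¹) := by
  classical
  have hF : Measurable fun x => L 0 x * U n x :=
    (measurable_lower hsv hL 0).mul (measurable_upper hsv hU n)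
  have hAB : (Ico 0 m).image c ∪ (Ico (m + 1) (n + 1)).image c = univ := by
    ext e
    simp only [mem_union, mem_image, mem_Ico, mem_univ, iff_true]
    obtain ⟨k, hk, hkm, hce⟩ := hsurj e
    rcases Nat.lt_or_gt_of_ne hkm with h | h
    · exact Or.inl ⟨k, ⟨Nat.zero_le _, h⟩, hce⟩
    · exact Or.inr ⟨k, ⟨h, by omega⟩, hce⟩
  have hdisj : Disjoint ((Ico 0 m).image c) ((Ico (m + 1) (n + 1)).image c) := by
    rw [Finset.disjoint_left]
    intro e ha hb
    obtain ⟨k, hk, rfl⟩ := mem_image.1 ha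
    obtain ⟨k', hk', he⟩ := mem_image.1 hb
    rw [mem_Ico] at hk hk'
    have := hinj k' k (by omega) (by omega) (by omega) (by omega) he
    omega
  -- integrate the upper chain first (weight `L 0`), then the lower chain (constant weight)
  have hF' : (fun x => L 0 x * U n x) =
      fun x => L 0 x * (U n x * ENNReal.ofReal (sv x n ^ (-d (n + 1)))) := by
    funext x
    rw [hdn, neg_zero, Real.rpow_zero, ENNReal.ofReal_one, mul_one]
  have hB : lmarginal (fun _ => volume) ((Ico (m + 1) (n + 1)).image c)
      (fun x => L 0 x * U n x) =
      fun x => ENNReal.ofReal (∏ k ∈ Ico (m + 1) (n + 1), (d k)⁻¹) * L 0 x := by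
    rw [hF']
    exact lmarginal_upper hsv hU hinj (fun k hk hkn => hd k (by omega) hkn) hmn le_rfl (L 0)
      (measurable_lower hsv hL 0) fun x k t hk => lower_update hsv hL (Nat.zero_le m) (c k)
        (fun k' hk' hce => by
          rw [mem_Ico] at hk hk'
          have := hinj k' k (by omega) (by omega) (by omega) (by omega) hce
          omega) x t
  set C : ℝ≥0∞ := ENNReal.ofReal (∏ k ∈ Ico (m + 1) (n + 1), (d k)⁻¹) with hC
  have hA0 : (fun x => C * L 0 x) = fun x => C * (L 0 x * ENNReal.ofReal (sv x 0 ^ d 0)) := by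
    funext x
    rw [hd0, Real.rpow_zero, ENNReal.ofReal_one, mul_one]
  have hA : lmarginal (fun _ => volume) ((Ico 0 m).image c) (fun x => C * L 0 x) =
      fun _ => ENNReal.ofReal (∏ k ∈ Ico 1 (m + 1), (d k)⁻¹) * C := by
    rw [hA0]
    exact lmarginal_lower hsv hL hinj hmn (fun k hk hkm => hd k hk (hkm.trans hmn)) m 0
      (zero_add m) (fun _ => C) measurable_const fun _ _ _ _ => rfl
  have x₀ : Fin n → ℝ := fun _ => 0
  calc ∫⁻ x, L 0 x * U n x
      = lmarginal (fun _ => volume) univ (fun x => L 0 x * U n x) x₀ :=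
        lintegral_eq_lmarginal_univ x₀
    _ = lmarginal (fun _ => volume) ((Ico 0 m).image c)
          (lmarginal (fun _ => volume) ((Ico (m + 1) (n + 1)).image c)
            (fun x => L 0 x * U n x)) x₀ := by
        rw [← hAB, lmarginal_union _ _ hF hdisj]
    _ = ENNReal.ofReal (∏ k ∈ Ico 1 (m + 1), (d k)⁻¹) * C := by rw [hB, hA]
    _ = ENNReal.ofReal (∏ k ∈ Ico 1 (n + 1), (d k)⁻¹) := by
        rw [hC, ← ENNReal.ofReal_mul (prod_nonneg fun k hk => inv_nonneg.2
            (hd k (mem_Ico.1 hk).1 (by have := (mem_Ico.1 hk).2; omega)).le),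
          ← prod_union (Finset.Ico_disjoint_Ico_consecutive 1 (m + 1) (n + 1)),
          Finset.Ico_union_Ico_eq_Ico (by omega) (by omega)]

end Chains

end Literature.MathematicalPhysics.QuantumFieldTheory
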